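import Literature.MathematicalPhysics.QuantumFieldTheory.Balaban1983to89.B9SectBGpStepAtLettersV2
import Literature.MathematicalPhysics.QuantumFieldTheory.Balaban1983to89.B9Thm34GUniformR1
import Literature.MathematicalPhysics.QuantumFieldTheory.Balaban1983to89.B9SectBGStepAtLetters

/-!
# `Balaban1983to89.B9SectBGStepAtLettersV2` — [B9] Sect. B, the (3.42)-, (3.47)- and analytic-extension steps for the bond-sector
# operator G(U′U) (Theorem 3.4 p. 400 with Theorem 3.3 p. 399; p. 407 (3.84)–(3.86)) PINNED AT THE LETTERS, FRAMES V2: `GFrame₂`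
# (extends `B9SectBGpStepAtLettersV2.CinvFrame₂`, whose [4] Lemma-2.1 fields are M-thresholded and rate-capped), ★ `entries342_ext_of_gFrame₂`,
# ★ `stepEPos_of_gFrame₂ : GFrame₂ … → StepEPos … GA`, `GlobGFrame₂` ∕ ★ `stepGlobPos_of_globGFrame₂`, `AnGFrame₂` ∕
# ★ `stepAnalyticPos1_of_anGFrame₂` — over the R1-restated r06 theorems `B9Thm34GUniformR1.thm34_G_clause_uniform`,
# `B9Thm34SectBUniformR1.thm34_Gp_uniform`

T. Bałaban, *Propagators for lattice gauge theories in a background field*, Commun. Math. Phys. **99** (1985) 389–434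
[`Balaban1985BackgroundPropagators`, "B9"]; [4] = T. Bałaban, *Propagators and renormalization transformations for lattice
gauge theories. II*, Commun. Math. Phys. **96** (1984) 223–250 [`Balaban1984PropagatorsII`].

statement-level skeleton of published theorems with citation tags; proofs where landed; nothing here is a claim about the
Yang–Mills mass gap

THE PRINTED LOCUS (verbatim).  Theorem 3.4, p. 400: *"There exists a positive constant a₁ such that the operators G′(U),
(Q′(U)G′²(U)Q′*(U))⁻¹, R(U), G(U) extend to configurations U′U for α₁ ≦ a₁ as analytic functions of A. The extended
operators satisfy all the inequalities of Theorems 3.1–3.3 correspondingly."*; Theorem 3.3 p. 399: *"the operator G(U) (a = 1)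
satisfies the inequalities (3.42)–(3.47), with G′(U) replaced by G(U) and λ replaced by a function J defined at bonds of the
lattice"*; p. 407, (3.82)–(3.86): *"Δ_a(U′U) = Δ_a(U) − V(A) … G(U′U) = G(U)(I − V(A)G(U))⁻¹ = Σ_{n=0}^∞ G(U)(V(A)G(U))ⁿ … for α₁
sufficiently small the series is convergent … This way we get all these inequalities for the operator G(U′U)"*; (3.68) p. 403:
*"P(U′U) = P(U) + P′(A)"*; (3.25) p. 394, (3.30) p. 395.  [4] Lemma 2.1 p. 234 with (2.59) p. 233 («Now we require that RM is
sufficiently large»).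

THE POINT (v2).  `B9SectBGStepAtLetters` (this seat's gen 3) framed the G-steps on the letters of `CinvFrame` ⊂ `GFrame`; like every
v1 frame it inherited `GpFrame`'s [4] Lemma-2.1 fields in r06's «for every 0 < α < 1, at every rate, no M-threshold» shape, which
are UNSATISFIABLE over a multiscale family (LOCATED-4; see the header of `B9SectBGpStepAtLettersV2`).  THIS FILE is the v2 of its
KERNEL-FREE part: `GFrame₂` = `GFrame` with the parent replaced by `CinvFrame₂` (so `δcap`, `M261`, `MST` and the thresholded ∕
capped `h261` ∕ `hST` come from `GpFrame₂`; all G-specific fields byte for byte as in v1 — the bond letters `Gb Qb Qsb ab F₂ F₂s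
LapB`, the section `rep`, the laws `gb_eq` ∕ `reg_ginv` ∕ `coord_mul` ∕ `qb_mul` ∕ `reg335` ∕ `cplxG`, the sizes `hQb` ∕ `hQsb` ∕
`hF₂` ∕ `ha324`, the readings `readG342` ∕ `writeG342`), and ★ `entries342_ext_of_gFrame₂` ∕ ★ `stepEPos_of_gFrame₂` ∕ `GlobGFrame₂`
∕ ★ `stepGlobPos_of_globGFrame₂` ∕ `AnGFrame₂` ∕ ★ `stepAnalyticPos1_of_anGFrame₂`, whose proofs are the v1 proofs calling the
R1-restated `B9Thm34GUniformR1.thm34_G_clause_uniform` ∕ `B9Thm34SectBUniformR1.thm34_Gp_uniform` at the call rate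
`δr = min(min(δ₀, δ₁), δcap)` with the threshold `Mthr δr` and the frame's `h261_of` ∕ `hST_of`.  NOT carried over to v2: `KerGFrame`
∕ `L2GFrame` ∕ `H1GFrame` (and `B9SectBGStepAtLettersMore`'s `E4H2GFrame`, `L2SecondDiffGFrame`, `L2RightDiffGFrame`) — their r06
routes consume Theorem 3.3 for G(U) in the KERNEL form (`HasKernelBound` letters, via `B9Thm34AllUniform`), which the
lit-balaban desk (pub-ymgap ME #13, 2026-08-26) records as unsatisfied by Bałaban's own propagators on multi-point blocks for
d ≥ 3; those steps stay DISPLAYED positive-input hypotheses in the v2 capstone `B9SectBStepFrameV2.SectBFrame₂`.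

THE LEMMA-2.1 INPUT OF THE BOND-SECTOR STEPS IS AN EXPLICIT DATUM WITH A RATE-DEPENDENT EXPONENT (v2.1).  r06's `thm34_G_clause_uniform`
∕ `thm34_Cinv_uniform` use ONE `d` both as the exponent of [4] (2.61)'s c₁(α) = 12c₀(½α)^d and as the exponent of the (3.48) pairing weight
`B9Thm34Inv.vol g d = (L^{j′}η)^d`.  The second role is immaterial: a (3.48)-type kernel bound `|T(y,y′)| ≦ c(Lʲη)⁻⁴(L^{j′}η)^{−d}E(y,y′)` w.r.t.
`vol g d` is the same inequality on the matrix entries for every `d` (`kerBound_exp_change`, from `B9Thm34Inv.ker_le_iff` ∕ `vol_inv`).  So the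
G steps here take their Lemma-2.1 input as an explicit datum `(d261 : ℝ → ℕ)`, `h261 : ∀ i δ α, 0 < δ → δ ≤ δcap → 9/5000 ≤ α → α < 1 → M261 δ ≤
(geo i).M → Ineq261 (d261 δ) (toB6 (geo i) …) δ α` — (2.61) in printed shape at every rate with an exponent DEPENDING ON THE RATE, the shape
the record geometry supplies by name (dag-n06-k `B9RWSums347DefiniteFacesWindow.ineq261_fn_geo9Y`, from the opaque per-rate schema
`rowSum261_geo9Y` by antitonicity in the rate) — and call the r06 theorems at `d := d261 δr`, converting the frame's (3.48) reading (exponent `dB`) on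
the way in.  The capstone `B9SectBStepFrameV2` feeds this datum from `GpFrame₂`'s own Lemma-2.1 field once that field carries the rate-dependent
exponent (v2.1 of `B9SectBGpStepAtLettersV2`); until then any `(d261, h261)` of the displayed shape will do.

THE ONE NON-BOOKKEEPING STEP (v1's `B9SectBGStepAtLetters.rZero_add_pPrime_sections`, imported, not restated).  r06's G-clause concludes that its `GExt` inverts the
concrete Δ_a(U′U) whose R-word is written THROUGH THE SECTION: `(G′Q′*C⁻¹Q′G′)(U) + P′(A)` with `P′(A) = pOp E (Q′*(U′U)∘rep*)
(rep_! C⁻¹(U′U) rep*) (rep_!∘Q′(U′U)) − pOp G′(U) (…U…)` ((3.68), `B9Eq360Vprime.pPrime`); for an injective section this IS the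
word `G′(U′U)Q′*(U′U)C⁻¹(U′U)Q′(U′U)G′(U′U)` read directly — so after the three uniqueness identifications (G′(U′U) = r06's
extension by `gop_eq`, C⁻¹(U′U) = r06's `Tinv` by `cop_eq`, then G(U′U) = r06's `GExt` by `gb_eq`) the transferred majorants are
majorants of the family's own G(U′U).

HONEST SCOPE.  Nothing of print is asserted and no operator of [B9] is constructed: `GFrame₂` is a hypothesis structure (the
contract an instance meets), NOT shown inhabited here; r06's (R1) theorems USED BY NAME; the theorems are quantifier bookkeeping +
uniqueness of two-sided inverses + the section identity.  Output `(wBG B (δr/6), wδG (δr/6))`; the rate cap and 9/5000 are proof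
devices («of course with different constants», p. 403).  Count-neutral; NOT a node discharge; nothing continuum ∕ OS ∕
mass-gap ∕ Clay.  Cell `pub-ymgap` (HUMAN RULING D-0062), Track A node N06 [B9], N06-ASSIGNMENT row 13 (steps 13-E(G), 13-Glob(G),
13-An(G)), seat `pub-ymgap-dag-n06-c` (g4), 2026-08-27.
-/

noncomputable section

namespace Literature.MathematicalPhysics.QuantumFieldTheory.Balaban1983to89.B9SectBGStepAtLettersV2

open Literature.MathematicalPhysics.QuantumFieldTheory.Balaban1983to89
open Literature.MathematicalPhysics.QuantumFieldTheory.Balaban1983to89.B6RandomWalk (HasMajorant hasMajorant_mono Triangle254 Ineq261)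
open Literature.MathematicalPhysics.QuantumFieldTheory.Balaban1983to89.B6RandomWalkHom (HasMajorantHom)
open Literature.MathematicalPhysics.QuantumFieldTheory.Balaban1983to89.B6RandomWalkSection (secExt secRes secConj secConj_def
  secRes_comp_secExt)
open Literature.MathematicalPhysics.QuantumFieldTheory.Balaban1983to89.B9Thm34Ext (toB6)
open Literature.MathematicalPhysics.QuantumFieldTheory.Balaban1983to89.B9Ineq347 (ScaleTransfer)
open Literature.MathematicalPhysics.QuantumFieldTheory.Balaban1983to89.B9Eq39Adjoint (covD covDstar prodCfg plaqU)
open Literature.MathematicalPhysics.QuantumFieldTheory.Balaban1983to89.B9Eq369Small (Through)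
open Literature.MathematicalPhysics.QuantumFieldTheory.Balaban1983to89.B9Eq372Locality (stBonds)
open Literature.MathematicalPhysics.QuantumFieldTheory.Balaban1983to89.B9Eq352DivForm (tauF tauB)
open Literature.MathematicalPhysics.QuantumFieldTheory.Balaban1983to89.B9Eq352DivFormLetters (conj)
open Literature.MathematicalPhysics.QuantumFieldTheory.Balaban1983to89.B9Eq352GradLetters (diffLetter)
open Literature.MathematicalPhysics.QuantumFieldTheory.Balaban1983to89.B9Eq371GradLetters (bT bU)
open Literature.MathematicalPhysics.QuantumFieldTheory.Balaban1983to89.B9Eq372RemLetters (lapDDLetter)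
open Literature.MathematicalPhysics.QuantumFieldTheory.Balaban1983to89.B9Eq382V3Letters (dPrimeLetter)
open Literature.MathematicalPhysics.QuantumFieldTheory.Balaban1983to89.B9Eq376POneLetters (conjHom gradLin divLin)
open Literature.MathematicalPhysics.QuantumFieldTheory.Balaban1983to89.B9Eq386Neumann (pTwo deltaA)
open Literature.MathematicalPhysics.QuantumFieldTheory.Balaban1983to89.B9Eq360Vprime (gPrimeExtEnd pPrime pOp)
open Literature.MathematicalPhysics.QuantumFieldTheory.Balaban1983to89.B9Eq360VprimeLetters (vPrimeConc)
open Literature.MathematicalPhysics.QuantumFieldTheory.Balaban1983to89.B9Thm34SectBUniformR1 (thm34_Gp_uniform)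
open Literature.MathematicalPhysics.QuantumFieldTheory.Balaban1983to89.B9Thm34GUniformR1 (thm34_G_clause_uniform)
open Literature.MathematicalPhysics.QuantumFieldTheory.Balaban1983to89.B6RandomWalkKernel (HasKernelBound hasKernelBound_mono)
open Literature.MathematicalPhysics.QuantumFieldTheory.Balaban1983to89.B9FromB6 (EBlock)
open Literature.MathematicalPhysics.QuantumFieldTheory.Balaban1983to89.B9SectBStepWhole (StepPos StepEPos)
open Literature.MathematicalPhysics.QuantumFieldTheory.Balaban1983to89.B9SectBGpStepAtLettersV2 (GpFrame₂ CinvFrame₂)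
open Literature.MathematicalPhysics.QuantumFieldTheory.Balaban1983to89.B9SectBGStepAtLetters (rZero_add_pPrime_sections)

universe u

variable {I : Type} (d : ℕ) (c35 : ℝ) (geo : I → B9.Geometry) (bg : I → B9.Backgrounds)
  (Gp : ∀ i, B9.KernelFamily (geo i) (bg i))
  {𝔸 : Type u} [NormedRing 𝔸] [NormedAlgebra ℂ 𝔸] [CompleteSpace 𝔸] {ι : Type} [Fintype ι] [DecidableEq ι]
  (b : Module.Basis ι ℝ 𝔸) (κ : Type) [Fintype κ] [LinearOrder κ]
  (S : I → Type) [∀ i, Fintype (S i)] [∀ i, DecidableEq (S i)]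
  [∀ i, Fintype (geo i).Site] [∀ i, DecidableEq (geo i).Site] [∀ i, Nonempty (geo i).Site]

/-- Rate bookkeeping for block majorants: a majorant `c·P(a)·e^{−δd}` with `c·P ≧ 0` stays one at any smaller rate `δ′ ≦ δ`
(d ≧ 0). [folklore] [cite: Balaban1984PropagatorsII, (2.51) p.232] -/
private theorem hasMajorant_rate_le {g : B6.Geometry} {X : Type} (blk : X → g.Site) {T : Module.End ℝ (X → ℝ)}
    {c δ δ' : ℝ} (P : g.Site → ℝ) (hc : ∀ a, 0 ≤ c * P a) (hδ : δ' ≤ δ) (hd : ∀ a a' : g.Site, 0 ≤ g.dist a a')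
    (h : HasMajorant blk T (fun a a' => c * P a * Real.exp (-(δ * g.dist a a')))) :
    HasMajorant blk T (fun a a' => c * P a * Real.exp (-(δ' * g.dist a a'))) :=
  hasMajorant_mono blk h fun a a' =>
    mul_le_mul_of_nonneg_left (Real.exp_le_exp.2 (by nlinarith [hd a a', hδ])) (hc a)

/-- The (3.48)-type kernel bound `|T(y,y′)| ≦ c(Lʲη)⁻⁴(L^{j′}η)^{−d}E(y,y′)` w.r.t. the volume pairing `vol g d` is the SAME inequality
on the matrix entries for every exponent `d` (the factor `(L^{j′}η)^{−d}` IS the reciprocal pairing weight): exponent change `d ↦ D`.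
Used to call the r06 chain at a Lemma-2.1 exponent decoupled from the frame's (3.48) exponent `dB`. [folklore]
[cite: Balaban1985BackgroundPropagators, Thm 3.2 (3.48) p.398] -/
private theorem kerBound_exp_change {g : B9.Geometry} [Fintype g.Site] [DecidableEq g.Site]
    (hlen : ∀ y : g.Site, 0 < g.len y) (T : Module.End ℝ (g.Site → ℝ)) {c : ℝ} {E : g.Site → g.Site → ℝ} (d D : ℕ)
    (h : ∀ y y' : g.Site, |B9Thm34Inv.ker (B9Thm34Inv.vol g d) T y y'| ≤
      c * g.len y ^ (-(4 : ℝ)) * g.len y' ^ (-(d : ℝ)) * E y y') :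
    ∀ y y' : g.Site, |B9Thm34Inv.ker (B9Thm34Inv.vol g D) T y y'| ≤
      c * g.len y ^ (-(4 : ℝ)) * g.len y' ^ (-(D : ℝ)) * E y y' := by
  intro y y'
  have hv : ∀ n : ℕ, 0 < B9Thm34Inv.vol g n y' := fun n => B9Thm34Inv.vol_pos n hlen y'
  have h1 := h y y'
  rw [← B9Thm34Inv.vol_inv d hlen y', show c * g.len y ^ (-(4 : ℝ)) * (B9Thm34Inv.vol g d y')⁻¹ * E y y' =
      (c * g.len y ^ (-(4 : ℝ)) * E y y') * (B9Thm34Inv.vol g d y')⁻¹ by ring] at h1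
  have key : |B9Thm34Inv.entry T y y'| ≤ c * g.len y ^ (-(4 : ℝ)) * E y y' :=
    (B9Thm34Inv.ker_le_iff _ (hv d) T y _).1 h1
  have h2 := (B9Thm34Inv.ker_le_iff _ (hv D) T y _).2 key
  rw [B9Thm34Inv.vol_inv D hlen y'] at h2
  calc |B9Thm34Inv.ker (B9Thm34Inv.vol g D) T y y'| ≤ (c * g.len y ^ (-(4 : ℝ)) * E y y') * g.len y' ^ (-(D : ℝ)) := h2
    _ = c * g.len y ^ (-(4 : ℝ)) * g.len y' ^ (-(D : ℝ)) * E y y' := by ring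

/-! ## The letters dictionary for the bond-sector family G -/

/-- **THE LETTERS DICTIONARY FOR THE G FAMILY** (Theorem 3.3's bond-sector operator `G(U) = Δ_a(U)⁻¹` (3.30), the `GA` family of
the N06 record) — `CinvFrame₂` (v2: the site-sector letters of G′ and C⁻¹ with their laws, the rate cap `δcap` and the M-thresholded
Lemma-2.1 fields) extended by EXACTLY the further hypotheses of r06's uniform G-clause `B9Thm34GUniformR1.thm34_G_clause_uniform` per member `i`: commuting shifts (`T_comm`), `1 ≦ L`
(`L_one_le`), the (3.35) plaquette reading at the bond's block scale with a frame-level constant `C₀` above the thresholds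
(`reg335`), the extra stencils (`stencilFB`, `stencilSt`, `stencilLoc`), a section of the block map (`rep`, `hrep` — FILE 17 of
r06), the bond letters `Gb i V` = G(V) (3.27)∕(3.30), `Qb i V` = Q(V), `Qsb i V` = Q*(V) (3.15), the weight letter `ab i` = a of
(3.24)∕(3.26) (`ha324`), the (3.80)–(3.81) variations `F₂ i U U′`, `F₂s i U U′`, the bond Laplacian letter `LapB i U` (fourth
(3.42) entry); the frame-level constants `C₀ κQb cFb abar`, the reading constant `cRG`, the writing
functions `wBG wδG`; and the LAWS: `gb_eq` (G(V) is THE two-sided inverse of the concrete Δ_a(V) of (3.30)∕(3.82)–(3.84) —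
r06's `deltaA` word in the letters at V with R(V) by the algebraic (3.25) — whenever one exists), `reg_ginv` (one exists at
(3.35)-regular U above the thresholds, Thm 3.3 ∕ 3.11), `coord_mul` (the background of U′U on the class (3.37) is
`prodCfg U η A`), `qb_mul` ((3.80)), `hQb`∕`hQsb`∕`hF₂` (block-majorant sizes of the bond letters at every rate `δ ≦ δcap`),
`cplxG` (the seven further blockwise (3.37) readings), `readG342` ∕ `writeG342` (the (3.42) block of `GA` ↔ block majorants of the
bond letters, both ways).  Field shapes = the hypotheses of `thm34_G_clause_uniform` verbatim (block-majorant letters only; NO kernel-form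
letter of G(U) — those enter r06's chain only above `B9Thm34GKernelUniform`, not used here).  A hypothesis structure; nothing asserted. [cite: Balaban1985BackgroundPropagators, Thm 3.4 p.400 + Thm 3.3 p.399 + (3.15) p.393 + (3.24)–(3.27) p.394 + (3.30) p.395 + (3.35)/(3.37) p.396 + Thm 3.1 (3.42) p.397 + (3.68) p.403 + (3.80)–(3.86) p.407 + Thm 3.11 p.416; Balaban1984PropagatorsII, (2.51) p.232 + Lemma 2.1 p.234] -/
structure GFrame₂ (GA : ∀ i, B9.KernelFamily (geo i) (bg i)) (Cinv : ∀ i, B9.SiteKernel (geo i) (bg i))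
    extends CinvFrame₂ c35 geo bg Gp b κ S Cinv where
  /-- (3.35) plaquette constant, (3.15) bond-letter size, (3.80)–(3.81) size, the weight bound ā of (3.24), reading constant and
  writing functions for the G family (the rate cap `δcap` is the parent's, v2). -/
  C₀ : ℝ
  κQb : ℝ
  cFb : ℝ
  abar : ℝ
  cRG : ℝ
  wBG : ℝ → ℝ → ℝ
  wδG : ℝ → ℝ
  C₀_nonneg : 0 ≤ C₀
  κQb_nonneg : 0 ≤ κQb
  cFb_nonneg : 0 ≤ cFb
  abar_nonneg : 0 ≤ abar
  cRG_pos : 0 < cRG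
  wBG_pos : ∀ B δ : ℝ, 0 ≤ B → 0 < δ → 0 < wBG B δ
  wδG_pos : ∀ δ : ℝ, 0 < δ → 0 < wδG δ
  /-- per member: the section of the block map, the bond letters. -/
  rep : ∀ i, (geo i).Site → S i × ι
  Gb : ∀ i, (bg i).Cfg → Module.End ℝ ((κ × S i) × ι → ℝ)
  Qb : ∀ i, (bg i).Cfg → Module.End ℝ ((κ × S i) × ι → ℝ)
  Qsb : ∀ i, (bg i).Cfg → Module.End ℝ ((κ × S i) × ι → ℝ)
  ab : ∀ i, Module.End ℝ ((κ × S i) × ι → ℝ)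
  F₂ : ∀ i, (bg i).Cfg → (bg i).Cfg → Module.End ℝ ((κ × S i) × ι → ℝ)
  F₂s : ∀ i, (bg i).Cfg → (bg i).Cfg → Module.End ℝ ((κ × S i) × ι → ℝ)
  LapB : ∀ i, (bg i).Cfg → Module.End ℝ ((κ × S i) × ι → ℝ)
  /-- `L ≧ 1`, commuting shifts, the section property `blk (rep y) = y`. -/
  L_one_le : ∀ i, 1 ≤ (geo i).L
  T_comm : ∀ i (μ ν : κ) (x : S i), T i μ (T i ν x) = T i ν (T i μ x)
  hrep : ∀ i (y : (geo i).Site), blk i (rep i y).1 = y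
  /-- the three further stencils of r06's G-clause at range `d₀`. -/
  stencilFB : ∀ i (μ ν : κ) (x : S i), (geo i).dist (blk i x) (blk i ((T i ν).symm (T i μ x))) ≤ d₀
  stencilSt : ∀ i (μ : κ) (x : S i) (q : κ × S i), q ∈ stBonds (T i) μ x → (geo i).dist (blk i x) (blk i q.2) ≤ d₀
  stencilLoc : ∀ i (μ : κ) (x : S i) (q : κ × S i), q ∈ B9Eq375Locality.locBondsA' (T i) μ x →
    (geo i).dist (blk i x) (blk i q.2) ≤ d₀
  /-- LAW (3.35) READ ON PLAQUETTES: at a (3.35)-regular U above the thresholds, every plaquette through a bond is within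
  `C₀·(L^{j})^{−2}` of 1 at that bond's block scale (frame-level `C₀`, since `Mα₀ ≦ aInv`). -/
  reg335 : ∀ i (α₀ : ℝ) (U : (bg i).Cfg), MInv ≤ (geo i).M → 0 < α₀ → (geo i).M * α₀ ≤ aInv → (bg i).Reg335 c35 α₀ U →
    ∀ (μ : κ) (x : S i) (m n : κ) (y : S i), Through (T i) μ x m n y →
      ‖(plaqU (T i) (coord i U) m n y : 𝔸) - 1‖ ≤ C₀ * (((geo i).L ^ (geo i).scale (blk i x))⁻¹) ^ 2
  /-- (3.15): Q(V), Q*(V) have block majorants `κQb·e^{−δd}` at every rate `0 < δ ≦ δcap` (block-local letters). -/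
  hQb : ∀ i (V : (bg i).Cfg) (δ : ℝ), 0 < δ → δ ≤ δcap →
    HasMajorant (g := toB6 (geo i) (Rr i) (Hp i)) (fun q : (κ × S i) × ι => blk i q.1.2) (Qb i V)
      (fun a a' => κQb * Real.exp (-(δ * (geo i).dist a a')))
  hQsb : ∀ i (V : (bg i).Cfg) (δ : ℝ), 0 < δ → δ ≤ δcap →
    HasMajorant (g := toB6 (geo i) (Rr i) (Hp i)) (fun q : (κ × S i) × ι => blk i q.1.2) (Qsb i V)
      (fun a a' => κQb * Real.exp (-(δ * (geo i).dist a a')))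
  /-- (3.24)∕(3.26): the weight letter `a` is block-diagonal with entries `≦ ā·(Lʲη)^{−2}`. -/
  ha324 : ∀ i, HasMajorant (g := toB6 (geo i) (Rr i) (Hp i)) (fun q : (κ × S i) × ι => blk i q.1.2) (ab i)
    (fun a a' : (geo i).Site => if a = a' then abar * ((geo i).len a ^ 2)⁻¹ else 0)
  /-- `G(V)` is THE two-sided inverse of the concrete `Δ_a(V)` (r06's `deltaA` word in the letters at V, R(V) by (3.25))
  whenever one exists (every configuration, complex ones included). -/
  gb_eq : ∀ i (V : (bg i).Cfg) (D X : Module.End ℝ ((κ × S i) × ι → ℝ)),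
    deltaA (conj b (lapDDLetter (T i) ((((geo i).eta : ℂ))⁻¹) (coord i V))) (conj b (dPrimeLetter (T i) (coord i V) (geo i).eta))
        (conjHom b (gradLin (T i) ((((geo i).eta : ℂ))⁻¹) (coord i V)) ∘ₗ
            (1 - (Gop i V ∘ₗ Qcs i V ∘ₗ Cop i V ∘ₗ Qc i V ∘ₗ Gop i V)) ∘ₗ
          conjHom b (divLin (T i) ((((geo i).eta : ℂ))⁻¹) (coord i V))) (Qsb i V) (ab i) (Qb i V) = D →
    D * X = 1 → X * D = 1 → Gb i V = X
  /-- Theorem 3.3 ∕ 3.11: at a (3.35)-regular U above the thresholds, the concrete Δ_a(U) is inverted by G(U). -/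
  reg_ginv : ∀ i (α₀ : ℝ) (U : (bg i).Cfg), MInv ≤ (geo i).M → 0 < α₀ → (geo i).M * α₀ ≤ aInv → (bg i).Reg335 c35 α₀ U →
    deltaA (conj b (lapDDLetter (T i) ((((geo i).eta : ℂ))⁻¹) (coord i U))) (conj b (dPrimeLetter (T i) (coord i U) (geo i).eta))
        (conjHom b (gradLin (T i) ((((geo i).eta : ℂ))⁻¹) (coord i U)) ∘ₗ
            (1 - (Gop i U ∘ₗ Qcs i U ∘ₗ Cop i U ∘ₗ Qc i U ∘ₗ Gop i U)) ∘ₗ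
          conjHom b (divLin (T i) ((((geo i).eta : ℂ))⁻¹) (coord i U))) (Qsb i U) (ab i) (Qb i U) * Gb i U = 1 ∧
    Gb i U * deltaA (conj b (lapDDLetter (T i) ((((geo i).eta : ℂ))⁻¹) (coord i U)))
        (conj b (dPrimeLetter (T i) (coord i U) (geo i).eta))
        (conjHom b (gradLin (T i) ((((geo i).eta : ℂ))⁻¹) (coord i U)) ∘ₗ
            (1 - (Gop i U ∘ₗ Qcs i U ∘ₗ Cop i U ∘ₗ Qc i U ∘ₗ Gop i U)) ∘ₗ
          conjHom b (divLin (T i) ((((geo i).eta : ℂ))⁻¹) (coord i U))) (Qsb i U) (ab i) (Qb i U) = 1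
  /-- on the class (3.37): U′ = e^{iηA} with A = `expA i U U′`, so the lattice field of U′U is `prodCfg U η A`. -/
  coord_mul : ∀ i (α₁ : ℝ) (U U' : (bg i).Cfg), 0 < α₁ → (bg i).Cplx337 α₁ U U' →
    coord i ((bg i).mul U' U) = prodCfg (coord i U) (geo i).eta (expA i U U')
  /-- (3.80): Q(U′U) = Q(U) + F₂(A), Q*(U′U) = Q*(U) + F₂*(A) on the class (3.37). -/
  qb_mul : ∀ i (α₁ : ℝ) (U U' : (bg i).Cfg), 0 < α₁ → (bg i).Cplx337 α₁ U U' →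
    Qb i ((bg i).mul U' U) = Qb i U + F₂ i U U' ∧ Qsb i ((bg i).mul U' U) = Qsb i U + F₂s i U U'
  /-- (3.81): `|F₂(A)|, |F₂*(A)| ≦ O(1)α₁` as block majorants `cFb·α₁·e^{−δd}` at every rate `0 < δ ≦ δcap`. -/
  hF₂ : ∀ i (α₁ : ℝ) (U U' : (bg i).Cfg), 0 < α₁ → (bg i).Cplx337 α₁ U U' → ∀ δ : ℝ, 0 < δ → δ ≤ δcap →
    HasMajorant (g := toB6 (geo i) (Rr i) (Hp i)) (fun q : (κ × S i) × ι => blk i q.1.2) (F₂ i U U')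
        (fun a a' => cFb * α₁ * Real.exp (-(δ * (geo i).dist a a'))) ∧
      HasMajorant (g := toB6 (geo i) (Rr i) (Hp i)) (fun q : (κ × S i) × ι => blk i q.1.2) (F₂s i U U')
        (fun a a' => cFb * α₁ * Real.exp (-(δ * (geo i).dist a a')))
  /-- the class (3.37) read blockwise: the seven FURTHER bounds of `thm34_G_clause_uniform` (beyond `cplx`). -/
  cplxG : ∀ i (α₁ : ℝ) (U U' : (bg i).Cfg), 0 < α₁ → (bg i).Cplx337 α₁ U U' →
    (∀ (μ ν : κ) (x : S i), ‖(((geo i).eta : ℂ))⁻¹ • covDstar (T i) (coord i U) ν (expA i U U' ν) (T i μ x)‖ ≤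
      α₁ * ((geo i).len (blk i x) ^ 2)⁻¹) ∧
    (∀ (μ ν k : κ) (x : S i), ‖(((geo i).eta : ℂ))⁻¹ • covD (T i) (coord i U) μ (expA i U U' k) ((T i ν).symm x)‖ ≤
      α₁ * ((geo i).len (blk i x) ^ 2)⁻¹) ∧
    (∀ (μ k : κ) (x : S i), ‖tauF (T i) (coord i U) μ (expA i U U' k) x‖ ≤ α₁ * ((geo i).len (blk i x))⁻¹) ∧
    (∀ (k μ ν : κ) (x : S i), ‖expA i U U' k ((T i ν).symm (T i μ x))‖ ≤ α₁ * ((geo i).len (blk i x))⁻¹) ∧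
    (∀ (μ : κ) (x : S i) (m : κ) (z : S i), (m, z) ∈ stBonds (T i) μ x → ‖expA i U U' m z‖ ≤ α₁ * ((geo i).len (blk i x))⁻¹) ∧
    (∀ (μ : κ) (x : S i) (m : κ) (z : S i), (m, z) ∈ B9Eq375Locality.locBondsA (T i) μ x →
      ‖expA i U U' m z‖ ≤ α₁ * ((geo i).len (blk i x))⁻¹) ∧
    (∀ (μ : κ) (x : S i) (m n : κ) (y : S i), Through (T i) μ x m n y →
      ‖covD (T i) (coord i U) m (expA i U U' n) y‖ ≤ (geo i).eta * (α₁ * (((geo i).len (blk i x))⁻¹) ^ 2) ∧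
        ‖covD (T i) (coord i U) n (expA i U U' m) y‖ ≤ (geo i).eta * (α₁ * (((geo i).len (blk i x))⁻¹) ^ 2))
  /-- READING: the (3.42) block of `GA` at U with (B₀, δ) ⇒ block majorants of the four bond letters of G(U) with (cRG·B₀, δ). -/
  readG342 : ∀ i (α₀ : ℝ) (U : (bg i).Cfg) (B₀ δ : ℝ), MInv ≤ (geo i).M → 0 < α₀ → (geo i).M * α₀ ≤ aInv →
    (bg i).Reg335 c35 α₀ U → 0 < B₀ → 0 < δ → EBlock (GA i) B₀ δ U →
    HasMajorant (g := toB6 (geo i) (Rr i) (Hp i)) (fun q : (κ × S i) × ι => blk i q.1.2) (Gb i U)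
        (fun a a' => cRG * B₀ * (geo i).len a ^ 2 * Real.exp (-(δ * (geo i).dist a a'))) ∧
      (∀ k : κ ⊕ κ, HasMajorant (g := toB6 (geo i) (Rr i) (Hp i)) (fun q : (κ × S i) × ι => blk i q.1.2)
        (conj b (diffLetter (bT (T i)) (bU (coord i U)) ((((geo i).eta : ℂ))⁻¹) k) * Gb i U)
        (fun a a' => cRG * B₀ * (geo i).len a * Real.exp (-(δ * (geo i).dist a a')))) ∧
      (∀ k : κ ⊕ κ, HasMajorant (g := toB6 (geo i) (Rr i) (Hp i)) (fun q : (κ × S i) × ι => blk i q.1.2)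
        (Gb i U * conj b (diffLetter (bT (T i)) (bU (coord i U)) ((((geo i).eta : ℂ))⁻¹) k))
        (fun a a' => cRG * B₀ * (geo i).len a * Real.exp (-(δ * (geo i).dist a a')))) ∧
      HasMajorant (g := toB6 (geo i) (Rr i) (Hp i)) (fun q : (κ × S i) × ι => blk i q.1.2) (LapB i U * Gb i U)
        (fun a a' => cRG * B₀ * 1 * Real.exp (-(δ * (geo i).dist a a')))
  /-- WRITING: block majorants of the four bond letters of G(U′U) (letters ∇_{U,k}, Δ_U at the real U) with (B, δ) ⇒ the (3.42)
  block of `GA` at U′U with (wBG B δ, wδG δ), for U′ in the class (3.37) at α₁ ≦ aW. -/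
  writeG342 : ∀ i (U U' : (bg i).Cfg) (α₁ B δ : ℝ), 0 < α₁ → α₁ ≤ aW → (bg i).Cplx337 α₁ U U' → 0 ≤ B → 0 < δ →
    HasMajorant (g := toB6 (geo i) (Rr i) (Hp i)) (fun q : (κ × S i) × ι => blk i q.1.2) (Gb i ((bg i).mul U' U))
        (fun a a' => B * (geo i).len a ^ 2 * Real.exp (-(δ * (geo i).dist a a'))) →
    (∀ k : κ ⊕ κ, HasMajorant (g := toB6 (geo i) (Rr i) (Hp i)) (fun q : (κ × S i) × ι => blk i q.1.2)
        (conj b (diffLetter (bT (T i)) (bU (coord i U)) ((((geo i).eta : ℂ))⁻¹) k) * Gb i ((bg i).mul U' U))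
        (fun a a' => B * (geo i).len a * Real.exp (-(δ * (geo i).dist a a')))) →
    (∀ k : κ ⊕ κ, HasMajorant (g := toB6 (geo i) (Rr i) (Hp i)) (fun q : (κ × S i) × ι => blk i q.1.2)
        (Gb i ((bg i).mul U' U) * conj b (diffLetter (bT (T i)) (bU (coord i U)) ((((geo i).eta : ℂ))⁻¹) k))
        (fun a a' => B * (geo i).len a * Real.exp (-(δ * (geo i).dist a a')))) →
    HasMajorant (g := toB6 (geo i) (Rr i) (Hp i)) (fun q : (κ × S i) × ι => blk i q.1.2)
        (LapB i U * Gb i ((bg i).mul U' U)) (fun a a' => B * 1 * Real.exp (-(δ * (geo i).dist a a'))) →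
    EBlock (GA i) (wBG B δ) (wδG δ) ((bg i).mul U' U)

variable {d c35 geo bg Gp b κ S}

/-- The frame's concrete `Δ_a(V)` word ((3.30) ∕ (3.82)–(3.84) in r06's letters at V, with R(V) by the algebraic (3.25)):
the `D` of the laws `gb_eq` ∕ `reg_ginv`. [cite: Balaban1985BackgroundPropagators, (3.30) p.395 + (3.25) p.394 + (3.82)–(3.84) p.407] -/
def GFrame₂.DeltaA {GA : ∀ i, B9.KernelFamily (geo i) (bg i)} {Cinv : ∀ i, B9.SiteKernel (geo i) (bg i)}
    (F : GFrame₂ c35 geo bg Gp b κ S GA Cinv) (i : I) (V : (bg i).Cfg) : Module.End ℝ ((κ × S i) × ι → ℝ) :=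
  deltaA (conj b (lapDDLetter (F.T i) ((((geo i).eta : ℂ))⁻¹) (F.coord i V)))
    (conj b (dPrimeLetter (F.T i) (F.coord i V) (geo i).eta))
    (conjHom b (gradLin (F.T i) ((((geo i).eta : ℂ))⁻¹) (F.coord i V)) ∘ₗ
        (1 - (F.Gop i V ∘ₗ F.Qcs i V ∘ₗ F.Cop i V ∘ₗ F.Qc i V ∘ₗ F.Gop i V)) ∘ₗ
      conjHom b (divLin (F.T i) ((((geo i).eta : ℂ))⁻¹) (F.coord i V))) (F.Qsb i V) (F.ab i) (F.Qb i V)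

omit [DecidableEq ι] [∀ i, DecidableEq (S i)] [∀ i, Nonempty (geo i).Site] in
/-- `reg_ginv` in terms of `GFrame₂.DeltaA`. [cite: Balaban1985BackgroundPropagators, Thm 3.3 p.399 + Thm 3.11 p.416] -/
theorem GFrame₂.deltaA_mul_gb {GA : ∀ i, B9.KernelFamily (geo i) (bg i)} {Cinv : ∀ i, B9.SiteKernel (geo i) (bg i)}
    (F : GFrame₂ c35 geo bg Gp b κ S GA Cinv) (i : I) (α₀ : ℝ) (U : (bg i).Cfg) (hM : F.MInv ≤ (geo i).M) (hα₀ : 0 < α₀)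
    (hMa : (geo i).M * α₀ ≤ F.aInv) (hU : (bg i).Reg335 c35 α₀ U) :
    F.DeltaA i U * F.Gb i U = 1 ∧ F.Gb i U * F.DeltaA i U = 1 :=
  F.reg_ginv i α₀ U hM hα₀ hMa hU

omit [DecidableEq ι] [∀ i, DecidableEq (S i)] [∀ i, Nonempty (geo i).Site] in
/-- `gb_eq` in terms of `GFrame₂.DeltaA`: G(V) is the unique two-sided inverse of Δ_a(V). [cite: Balaban1985BackgroundPropagators, (3.30) p.395] -/
theorem GFrame₂.gb_eq_of_inv {GA : ∀ i, B9.KernelFamily (geo i) (bg i)} {Cinv : ∀ i, B9.SiteKernel (geo i) (bg i)}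
    (F : GFrame₂ c35 geo bg Gp b κ S GA Cinv) (i : I) (V : (bg i).Cfg) (X : Module.End ℝ ((κ × S i) × ι → ℝ))
    (h1 : F.DeltaA i V * X = 1) (h2 : X * F.DeltaA i V = 1) : F.Gb i V = X :=
  F.gb_eq i V _ X rfl h1 h2

/-! ## ★ The (3.42) entries of G(U′U) at the letters, the (3.42)-step and the (3.47)-step -/

/-- **The (3.42) entries of G(U′U) at the letters** — the common core of the (3.42)- and (3.47)-steps for the bond-sector
family: for every input `(B₀, δ₀, B₁, δ₁) > 0` there are `a₁ > 0`, `B ≧ 0` (before the member) such that at every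
(3.35)-regular U above the threshold `Mthr δr` with the (3.42) blocks of `Gp` and `GA` at (B₀, δ₀) and the (3.48) kernel of `Cinv` at
(B₁, δ₁), and every U′ in (3.37) at α₁ ≦ a₁, the family's `G(U′U)` carries the four majorants (entry, left differences, right
differences, Laplacian letter) at `(B, δr/6)`, `δr = min(min(δ₀, δ₁), δcap)`, and inverts the frame's Δ_a(U′U) word
`F.DeltaA i (U′U)` on both sides (the analytic-extension clause) — GIVEN the Lemma-2.1 datum `(d261, h261)` of the module header (v2.1:
rate-dependent exponent).  Proof = r06's `thm34_G_clause_uniform` (R1) at δr and exponent `d261 δr` (all inputs lowered to δr; the (3.48)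
reading moved to that exponent by `kerBound_exp_change`; the scale transfers from `hST_of`); `thm34_Gp_uniform` (R1) for the inverse identities of the G′ extension; then three uniqueness identifications —
the family's G′(U′U) IS r06's extension (`gop_eq` ∘ `mul_law`), its C⁻¹(U′U) IS r06's `Tinv` (`cop_eq`, (3.57) `q_mul`), and, after
the section identity `rZero_add_pPrime_sections` and `coord_mul`, its G(U′U) IS r06's `GExt` (`gb_eq`, (3.80) `qb_mul`).
[cite: Balaban1985BackgroundPropagators, Thm 3.4 p.400 + Thm 3.3 p.399 + (3.80)–(3.86) p.407 + (3.68) p.403 + (3.57)–(3.65) p.402 + Thm 3.1 (3.42) p.397 + Thm 3.11 p.416; Balaban1984PropagatorsII, Lemma 2.1 (2.61) p.234] -/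
theorem entries342_ext_of_gFrame₂ {GA : ∀ i, B9.KernelFamily (geo i) (bg i)} {Cinv : ∀ i, B9.SiteKernel (geo i) (bg i)}
    (F : GFrame₂ c35 geo bg Gp b κ S GA Cinv) (d261 : ℝ → ℕ)
    (h261 : ∀ (i : I) (δ α : ℝ), 0 < δ → δ ≤ F.δcap → 9 / 5000 ≤ α → α < 1 → F.M261 δ ≤ (geo i).M →
      Ineq261 (d261 δ) (toB6 (geo i) (F.Rr i) (F.Hp i)) δ α)
    {B₀ δ₀ B₁ δ₁ : ℝ} (hB₀ : 0 < B₀) (hδ₀ : 0 < δ₀) (hB₁ : 0 < B₁) (hδ₁ : 0 < δ₁) :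
    ∃ a₁ : ℝ, 0 < a₁ ∧ ∃ B : ℝ, 0 ≤ B ∧
      ∀ (i : I) (α₀ : ℝ) (U : (bg i).Cfg), F.Mthr (min (min δ₀ δ₁) F.δcap) ≤ (geo i).M → 0 < α₀ → (geo i).M * α₀ ≤ F.aInv →
        (bg i).Reg335 c35 α₀ U → EBlock (Gp i) B₀ δ₀ U →
        (∀ y y' : (geo i).Site, |(Cinv i).ker U y y'| ≤
          B₁ * ((geo i).len y) ^ (-(4 : ℝ)) * ((geo i).len y') ^ (-(F.dB : ℝ)) * Real.exp (-(δ₁ * (geo i).dist y y'))) →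
        EBlock (GA i) B₀ δ₀ U →
        ∀ (α₁ : ℝ) (U' : (bg i).Cfg), 0 < α₁ → α₁ ≤ a₁ → (bg i).Cplx337 α₁ U U' →
          (F.DeltaA i ((bg i).mul U' U) * F.Gb i ((bg i).mul U' U) = 1 ∧
            F.Gb i ((bg i).mul U' U) * F.DeltaA i ((bg i).mul U' U) = 1) ∧
          HasMajorant (g := toB6 (geo i) (F.Rr i) (F.Hp i)) (fun q : (κ × S i) × ι => F.blk i q.1.2) (F.Gb i ((bg i).mul U' U))
              (fun a a' => B * (geo i).len a ^ 2 * Real.exp (-(min (min δ₀ δ₁) F.δcap / 6 * (geo i).dist a a'))) ∧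
            (∀ k : κ ⊕ κ, HasMajorant (g := toB6 (geo i) (F.Rr i) (F.Hp i)) (fun q : (κ × S i) × ι => F.blk i q.1.2)
              (conj b (diffLetter (bT (F.T i)) (bU (F.coord i U)) ((((geo i).eta : ℂ))⁻¹) k) * F.Gb i ((bg i).mul U' U))
              (fun a a' => B * (geo i).len a * Real.exp (-(min (min δ₀ δ₁) F.δcap / 6 * (geo i).dist a a')))) ∧
            (∀ k : κ ⊕ κ, HasMajorant (g := toB6 (geo i) (F.Rr i) (F.Hp i)) (fun q : (κ × S i) × ι => F.blk i q.1.2)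
              (F.Gb i ((bg i).mul U' U) * conj b (diffLetter (bT (F.T i)) (bU (F.coord i U)) ((((geo i).eta : ℂ))⁻¹) k))
              (fun a a' => B * (geo i).len a * Real.exp (-(min (min δ₀ δ₁) F.δcap / 6 * (geo i).dist a a')))) ∧
            HasMajorant (g := toB6 (geo i) (F.Rr i) (F.Hp i)) (fun q : (κ × S i) × ι => F.blk i q.1.2)
              (F.LapB i U * F.Gb i ((bg i).mul U' U))
              (fun a a' => B * 1 * Real.exp (-(min (min δ₀ δ₁) F.δcap / 6 * (geo i).dist a a'))) := by
  classical
  -- the common rate of the call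
  have hδr : 0 < min (min δ₀ δ₁) F.δcap := lt_min (lt_min hδ₀ hδ₁) F.δcap_pos
  have hδr0 : min (min δ₀ δ₁) F.δcap ≤ δ₀ := le_trans (min_le_left _ _) (min_le_left _ _)
  have hδr1 : min (min δ₀ δ₁) F.δcap ≤ δ₁ := le_trans (min_le_left _ _) (min_le_right _ _)
  have hδrc : min (min δ₀ δ₁) F.δcap ≤ F.δcap := min_le_right _ _
  have hBG : 0 < F.cR * B₀ := mul_pos F.cR_pos hB₀
  have hBb : 0 < F.cRG * B₀ := mul_pos F.cRG_pos hB₀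
  have hBK : 0 < F.cK * B₁ := mul_pos F.cK_pos hB₁
  -- r06's uniform Theorem-3.4 clauses: G′ (for the inverse identities of the extension) and G
  obtain ⟨a₁, ha₁, B', -, H'⟩ := thm34_Gp_uniform b κ (d261 (min (min δ₀ δ₁) F.δcap)) (min (min δ₀ δ₁) F.δcap) (F.cR * B₀) F.Cq F.a₀ F.d₀ F.M₂
    (F.Λf (min (min δ₀ δ₁) F.δcap)) hBG F.Cq_nonneg F.a₀_nonneg F.M₂_nonneg hδr
    (fun α hα => F.Λf_one_le _ α hδr hα) F.hrepr
  obtain ⟨a₂, ha₂, B, hB, H⟩ := thm34_G_clause_uniform b κ (d261 (min (min δ₀ δ₁) F.δcap)) (min (min δ₀ δ₁) F.δcap) (F.cRG * B₀) F.κQ (F.cR * B₀)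
    (F.cK * B₁) F.cF F.Cq F.a₀ F.C₀ F.d₀ F.M₂ F.κQb F.cFb F.abar (F.Λf (min (min δ₀ δ₁) F.δcap)) hBb.le F.κQ_pos hBG hBK
    F.cF_pos F.Cq_nonneg F.a₀_nonneg F.C₀_nonneg F.M₂_nonneg hδr F.κQb_nonneg F.cFb_nonneg F.abar_nonneg
    (fun α hα => F.Λf_one_le _ α hδr hα) F.hrepr
  refine ⟨min a₁ a₂, lt_min ha₁ ha₂, B, hB, ?_⟩
  intro i α₀ U hM0 hα₀ hMa hU hEp hKer hEG α₁ U' hα₁ ha hU'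
  have hM : F.MInv ≤ (geo i).M := F.MInv_le_of_Mthr_le hM0
  have ha1 : α₁ ≤ a₁ := le_trans ha (min_le_left _ _)
  have ha2 : α₁ ≤ a₂ := le_trans ha (min_le_right _ _)
  -- the site-sector letters at U: G′(U) inverts Δ′_a(U); (3.42)₀,₁,₂ of G′ at δ₀ lowered to δr
  obtain ⟨hΔG, hGΔ⟩ := F.reg_inv i α₀ U hM hα₀ hMa hU
  obtain ⟨h1, h2, h3, -⟩ := F.read342 i α₀ U B₀ δ₀ hM hα₀ hMa hU hB₀ hδ₀ hEp
  have hc2 : ∀ a : (geo i).Site, 0 ≤ F.cR * B₀ * (geo i).len a ^ 2 := fun a => mul_nonneg hBG.le (sq_nonneg _)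
  have hc1 : ∀ a : (geo i).Site, 0 ≤ F.cR * B₀ * (geo i).len a := fun a => mul_nonneg hBG.le (F.len_pos i a).le
  have h1' := hasMajorant_rate_le (g := toB6 (geo i) (F.Rr i) (F.Hp i)) (fun p : S i × ι => F.blk i p.1)
    (fun a => (geo i).len a ^ 2) hc2 hδr0 (F.dist_nonneg i) h1
  have h2' := fun k => hasMajorant_rate_le (g := toB6 (geo i) (F.Rr i) (F.Hp i)) (fun p : S i × ι => F.blk i p.1)
    (fun a => (geo i).len a) hc1 hδr0 (F.dist_nonneg i) (h2 k)
  have h3' := fun k => hasMajorant_rate_le (g := toB6 (geo i) (F.Rr i) (F.Hp i)) (fun p : S i × ι => F.blk i p.1)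
    (fun a => (geo i).len a) hc1 hδr0 (F.dist_nonneg i) (h3 k)
  -- the (3.48) kernel of C⁻¹(U) at δ₁ lowered to δr
  have hK := F.readKer i α₀ U B₁ δ₁ hM hα₀ hMa hU hB₁ hδ₁ hKer
  have hK' : ∀ y y' : (geo i).Site, |B9Thm34Inv.ker (B9Thm34Inv.vol (geo i) F.dB) (F.Cop i U) y y'| ≤
      F.cK * B₁ * (geo i).len y ^ (-(4 : ℝ)) * (geo i).len y' ^ (-(F.dB : ℝ)) *
        Real.exp (-(min (min δ₀ δ₁) F.δcap * (geo i).dist y y')) := by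
    intro y y'
    refine (hK y y').trans (mul_le_mul_of_nonneg_left (Real.exp_le_exp.2 ?_) ?_)
    · nlinarith [F.dist_nonneg i y y', hδr1]
    · exact mul_nonneg (mul_nonneg hBK.le (Real.rpow_nonneg (F.len_pos i y).le _))
        (Real.rpow_nonneg (F.len_pos i y').le _)
  -- the Lemma-2.1 exponent of the call is `d261 δr`, decoupled from the (3.48) exponent `dB`: the kernel bound is exponent-free
  have hK'' := kerBound_exp_change (F.len_pos i) (F.Cop i U) F.dB (d261 (min (min δ₀ δ₁) F.δcap)) hK'
  -- the bond-sector letters at U: G(U) inverts Δ_a(U); (3.42) of G at δ₀ lowered to δr; (3.15) sizes at δr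
  obtain ⟨hΔGb, hGbΔ⟩ := F.reg_ginv i α₀ U hM hα₀ hMa hU
  obtain ⟨g1, g2, g3, -⟩ := F.readG342 i α₀ U B₀ δ₀ hM hα₀ hMa hU hB₀ hδ₀ hEG
  have hb2 : ∀ a : (geo i).Site, 0 ≤ F.cRG * B₀ * (geo i).len a ^ 2 := fun a => mul_nonneg hBb.le (sq_nonneg _)
  have hb1 : ∀ a : (geo i).Site, 0 ≤ F.cRG * B₀ * (geo i).len a := fun a => mul_nonneg hBb.le (F.len_pos i a).le
  have g1' := hasMajorant_rate_le (g := toB6 (geo i) (F.Rr i) (F.Hp i)) (fun q : (κ × S i) × ι => F.blk i q.1.2)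
    (fun a => (geo i).len a ^ 2) hb2 hδr0 (F.dist_nonneg i) g1
  have g2' := fun k => hasMajorant_rate_le (g := toB6 (geo i) (F.Rr i) (F.Hp i)) (fun q : (κ × S i) × ι => F.blk i q.1.2)
    (fun a => (geo i).len a) hb1 hδr0 (F.dist_nonneg i) (g2 k)
  have g3' := fun k => hasMajorant_rate_le (g := toB6 (geo i) (F.Rr i) (F.Hp i)) (fun q : (κ × S i) × ι => F.blk i q.1.2)
    (fun a => (geo i).len a) hb1 hδr0 (F.dist_nonneg i) (g3 k)
  have hQb := F.hQb i U _ hδr hδrc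
  have hQsb := F.hQsb i U _ hδr hδrc
  -- the class (3.37) read blockwise; the (3.57), (3.80)–(3.81) letters; (3.35) on plaquettes
  obtain ⟨hkF, hsF, h337B, h337F, h337Bτ, hA, hAτB⟩ := F.cplx i α₁ U U' hα₁ hU'
  obtain ⟨h337B', h337FB, hAτF, hAFB, hAst, hAloc, hdAst⟩ := F.cplxG i α₁ U U' hα₁ hU'
  obtain ⟨hQm, hQsm⟩ := F.q_mul i α₁ U U' hα₁ hU'
  obtain ⟨hFc, hFcs⟩ := F.hF i α₁ U U' hα₁ hU'
  obtain ⟨hQbm, hQsbm⟩ := F.qb_mul i α₁ U U' hα₁ hU'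
  obtain ⟨hF₂, hF₂s⟩ := F.hF₂ i α₁ U U' hα₁ hU' _ hδr hδrc
  have h35 := F.reg335 i α₀ U hM hα₀ hMa hU
  -- the G′ clause: the inverse identities of the extension ⇒ the family's G′(U′U) is r06's extension
  obtain ⟨hinv1, hinv2, -, -⟩ := H' (F.T i) (F.coord i U) (F.blk i) (F.kQ i U) (F.sQ i U) (F.cfun i) (F.w i U)
    (F.dist_nonneg i) (F.triangle i) (F.dist_self i) (F.dist_comm i) (F.len_pos i) (F.eta_le_len i) (F.eta_pos i)
    (fun α hα hα1 => h261 i _ α hδr hδrc hα hα1 (F.M261_le_of_Mthr_le hM0)) (F.hST_of i hδr hδrc hM0) (F.unitary i U)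
    (F.stencilB i) (F.stencilF i) (F.stencil0 i) (F.w_nonneg i U) (F.card_w i U) (F.hkQ i U) (F.hsQ i U) (F.hcfun i)
    hΔG hGΔ h1' h2' h3' α₁ hα₁.le ha1 (F.expA i U U') (F.kF i U U') (F.sF i U U')
    hkF hsF h337B h337F h337Bτ hA hAτB
  have hGp := F.gop_eq i ((bg i).mul U' U) _ _ (F.mul_law i α₁ U U' hα₁ hU') hinv1 hinv2
  -- the G clause
  obtain ⟨Tinv, GExt, hT1, hT2, hG1, hG2, hleft, hright⟩ := H (F.T i) (F.coord i U) (F.blk i) (F.kQ i U) (F.sQ i U)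
    (F.cfun i) (F.w i U)
    (F.dist_nonneg i) (F.triangle i) (F.dist_self i) (F.dist_comm i) (F.len_pos i) (F.eta_le_len i) (F.eta_pos i)
    (F.L_one_le i) (fun α hα hα1 => h261 i _ α hδr hδrc hα hα1 (F.M261_le_of_Mthr_le hM0)) (F.hST_of i hδr hδrc hM0) (F.T_comm i)
    (F.unitary i U) h35 (F.stencilB i) (F.stencilF i) (F.stencilFB i) (F.stencilSt i) (F.stencilLoc i) (F.stencil0 i)
    (F.w_nonneg i U) (F.card_w i U) (F.hkQ i U) (F.hsQ i U) (F.hcfun i)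
    h1' h2' h3' (F.rep i) (F.hrep i) (F.hQc i U) (F.hQcs i U) (F.reg_cinv i α₀ U hM hα₀ hMa hU) hK''
    hQb hQsb (F.ha324 i) hΔGb hGbΔ g1' g2' g3' α₁ hα₁.le ha2 (F.expA i U U') (F.kF i U U') (F.sF i U U')
    hkF hsF h337B h337F h337B' h337Bτ h337FB hA hAτB hAτF hAFB hAst hAloc hdAst hQm hQsm hFc hFcs hQbm hQsbm rfl hF₂ hF₂s
  -- (1) G′(U′U) = r06's extension; (2) C⁻¹(U′U) = r06's Tinv
  rw [← hGp] at hT1 hT2 hG1 hG2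
  have hC := F.cop_eq i ((bg i).mul U' U) _ Tinv rfl hT1 hT2
  rw [← hC] at hG1 hG2
  -- (3) the section identity: R₀ + P′(A) through `rep` is P(U′U) read directly; (4) the background of U′U
  have hinj : Function.Injective (F.rep i) := fun y₁ y₂ h => by
    have e := congrArg (fun p : S i × ι => F.blk i p.1) h
    simpa only [F.hrep] using e
  rw [rZero_add_pPrime_sections hinj, ← F.coord_mul i α₁ U U' hα₁ hU'] at hG1 hG2
  -- (5) G(U′U) = r06's GExt
  have hGb := F.gb_eq i ((bg i).mul U' U) _ GExt rfl hG1 hG2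
  rw [← hGb] at hleft hright hG1 hG2
  -- (6) the four entries of G(U′U) at (B, δr/6)
  have g1'' : HasMajorant (g := toB6 (geo i) (F.Rr i) (F.Hp i)) (fun q : (κ × S i) × ι => F.blk i q.1.2)
      (1 * F.Gb i U)
      (fun a a' => F.cRG * B₀ * (geo i).len a ^ 2 * Real.exp (-(min (min δ₀ δ₁) F.δcap * (geo i).dist a a'))) := by
    rw [one_mul]; exact g1'
  have e0 : HasMajorant (g := toB6 (geo i) (F.Rr i) (F.Hp i)) (fun q : (κ × S i) × ι => F.blk i q.1.2)
      (1 * F.Gb i ((bg i).mul U' U))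
      (fun a a' => B * (geo i).len a ^ 2 * Real.exp (-(min (min δ₀ δ₁) F.δcap / 6 * (geo i).dist a a'))) :=
    hleft 1 (fun a => (geo i).len a ^ 2) (fun a => sq_nonneg _) g1''
  rw [one_mul] at e0
  -- the Laplacian letter entry, read at δ₀ and lowered
  obtain ⟨-, -, -, gL⟩ := F.readG342 i α₀ U B₀ δ₀ hM hα₀ hMa hU hB₀ hδ₀ hEG
  have hb0 : ∀ _a : (geo i).Site, 0 ≤ F.cRG * B₀ * 1 := fun _ => mul_nonneg hBb.le zero_le_one
  have gL' := hasMajorant_rate_le (g := toB6 (geo i) (F.Rr i) (F.Hp i)) (fun q : (κ × S i) × ι => F.blk i q.1.2)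
    (fun _ => (1 : ℝ)) hb0 hδr0 (F.dist_nonneg i) gL
  exact ⟨⟨hG1, hG2⟩, e0, fun k => hleft _ (fun a => (geo i).len a) (fun a => (F.len_pos i a).le) (g2' k),
    fun k => hright _ (g3' k), hleft _ (fun _ => (1 : ℝ)) (fun _ => zero_le_one) gL'⟩

/-- ★ **THE (3.42)-STEP OF SECT. B FOR G(U′U), INHABITED AT THE LETTERS**: every letters dictionary `GFrame₂` for the bond-sector
family `GA` inhabits the positive-input block-step `B9SectBStepWhole.StepEPos F.dB c35 geo bg Gp GA Cinv GA` (kernel exponent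
of the input tuple = the frame's dimension `dB`), by `entries342_ext_of_gFrame₂` and the frame's (3.42) writing, GIVEN the Lemma-2.1 datum
`(d261, h261)` (v2.1, module header).  Thresholds:
M ≧ Mthr δr (v2: invertibility, (2.59), scale transfer), Mα₀ ≦ aInv, α₁ ≦ min(a₁, aW); output constants `(wBG B (δr/6), wδG (δr/6))`,
`δr = min(min(δ₀, δ₁), δcap)`.  Nothing of
print asserted beyond what r06's theorems prove. [cite: Balaban1985BackgroundPropagators, Thm 3.4 p.400 + Thm 3.3 p.399 + (3.80)–(3.86) p.407 + Thm 3.1 (3.42) p.397] -/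
theorem stepEPos_of_gFrame₂ {GA : ∀ i, B9.KernelFamily (geo i) (bg i)} {Cinv : ∀ i, B9.SiteKernel (geo i) (bg i)}
    (F : GFrame₂ c35 geo bg Gp b κ S GA Cinv) (d261 : ℝ → ℕ)
    (h261 : ∀ (i : I) (δ α : ℝ), 0 < δ → δ ≤ F.δcap → 9 / 5000 ≤ α → α < 1 → F.M261 δ ≤ (geo i).M →
      Ineq261 (d261 δ) (toB6 (geo i) (F.Rr i) (F.Hp i)) δ α) :
    StepEPos F.dB c35 geo bg Gp GA Cinv GA := by
  intro B₀ δ₀ Bβ Bε Bεβ B₁ δ₁ hB₀ hδ₀ hB₁ hδ₁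
  obtain ⟨a₁, ha₁, B, hB, H⟩ := entries342_ext_of_gFrame₂ F d261 h261 hB₀ hδ₀ hB₁ hδ₁
  have hδ6 : 0 < min (min δ₀ δ₁) F.δcap / 6 := by
    have hδr : 0 < min (min δ₀ δ₁) F.δcap := lt_min (lt_min hδ₀ hδ₁) F.δcap_pos
    positivity
  refine ⟨F.Mthr (min (min δ₀ δ₁) F.δcap), min a₁ F.aW, F.aInv,
    (F.wBG B (min (min δ₀ δ₁) F.δcap / 6), F.wδG (min (min δ₀ δ₁) F.δcap / 6)), F.Mthr_pos _, lt_min ha₁ F.aW_pos, F.aInv_pos, ⟨F.wBG_pos B _ hB hδ6, F.wδG_pos _ hδ6⟩, ?_⟩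
  intro i hM α₀ hα₀ hMa U hU hT α₁ hα₁ ha U' hU'
  obtain ⟨-, e0, e1, e2, e3⟩ := H i α₀ U hM hα₀ hMa hU hT.1.1.1 hT.2.1 hT.2.2.1.1 α₁ U' hα₁
    (le_trans ha (min_le_left _ _)) hU'
  exact F.writeG342 i U U' α₁ B _ hα₁ (le_trans ha (min_le_right _ _)) hU' hB hδ6 e0 e1 e2 e3

/-! ## The (3.47) global block of G(U′U) at the letters -/

variable (c35 geo bg Gp b κ S) in
/-- **THE LETTERS DICTIONARY FOR THE GLOBAL BLOCK (3.47) OF G** — `GFrame₂` plus the writing of the four (3.42)-type majorants of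
`G(U′U)` as the (3.47) block of the family `GA` at U′U (the instance's (3.47)-from-(3.42) reading, p. 398 *"the global
inequalities (3.47) are consequences of the local ones (3.42) and Lemma 2.1"*, at the letters `B9Ineq347AllEntries` on the bond
carrier; writing function `wGG`).  A hypothesis structure; nothing asserted.
[cite: Balaban1985BackgroundPropagators, (3.47) p.398 + Thm 3.3 p.399 + p.407; Balaban1984PropagatorsII, Lemma 2.1 p.234] -/
structure GlobGFrame₂ (GA : ∀ i, B9.KernelFamily (geo i) (bg i)) (Cinv : ∀ i, B9.SiteKernel (geo i) (bg i))
    extends GFrame₂ c35 geo bg Gp b κ S GA Cinv where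
  wGG : ℝ → ℝ → ℝ
  wGG_pos : ∀ B δ : ℝ, 0 ≤ B → 0 < δ → 0 < wGG B δ
  /-- WRITING (3.47): the four majorants of G(U′U) at (B, δ) ⇒ the (3.47) block of `GA` at U′U with constant `wGG B δ`. -/
  writeGlobG : ∀ i (U U' : (bg i).Cfg) (α₁ B δ : ℝ), 0 < α₁ → α₁ ≤ aW → (bg i).Cplx337 α₁ U U' → 0 ≤ B → 0 < δ →
    HasMajorant (g := toB6 (geo i) (Rr i) (Hp i)) (fun q : (κ × S i) × ι => blk i q.1.2) (Gb i ((bg i).mul U' U))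
        (fun a a' => B * (geo i).len a ^ 2 * Real.exp (-(δ * (geo i).dist a a'))) →
    (∀ k : κ ⊕ κ, HasMajorant (g := toB6 (geo i) (Rr i) (Hp i)) (fun q : (κ × S i) × ι => blk i q.1.2)
        (conj b (diffLetter (bT (T i)) (bU (coord i U)) ((((geo i).eta : ℂ))⁻¹) k) * Gb i ((bg i).mul U' U))
        (fun a a' => B * (geo i).len a * Real.exp (-(δ * (geo i).dist a a')))) →
    (∀ k : κ ⊕ κ, HasMajorant (g := toB6 (geo i) (Rr i) (Hp i)) (fun q : (κ × S i) × ι => blk i q.1.2)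
        (Gb i ((bg i).mul U' U) * conj b (diffLetter (bT (T i)) (bU (coord i U)) ((((geo i).eta : ℂ))⁻¹) k))
        (fun a a' => B * (geo i).len a * Real.exp (-(δ * (geo i).dist a a')))) →
    HasMajorant (g := toB6 (geo i) (Rr i) (Hp i)) (fun q : (κ × S i) × ι => blk i q.1.2)
        (LapB i U * Gb i ((bg i).mul U' U)) (fun a a' => B * 1 * Real.exp (-(δ * (geo i).dist a a'))) →
    B9FromB6.GlobBlock (GA i) (wGG B δ) ((bg i).mul U' U)

/-- ★ **THE (3.47)-STEP OF SECT. B FOR G(U′U), INHABITED AT THE LETTERS**: every `GlobGFrame₂` inhabits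
`B9SectBStepWhole.StepGlobPos F.dB c35 geo bg Gp GA Cinv GA` (output constant `wGG B (δr/6)`), by `entries342_ext_of_gFrame₂` and
the frame's (3.47) writing, GIVEN the Lemma-2.1 datum `(d261, h261)` (v2.1). [cite: Balaban1985BackgroundPropagators, Thm 3.4 p.400 + (3.47) p.398 + Thm 3.3 p.399 + p.407] -/
theorem stepGlobPos_of_globGFrame₂ {GA : ∀ i, B9.KernelFamily (geo i) (bg i)} {Cinv : ∀ i, B9.SiteKernel (geo i) (bg i)}
    (F : GlobGFrame₂ c35 geo bg Gp b κ S GA Cinv) (d261 : ℝ → ℕ)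
    (h261 : ∀ (i : I) (δ α : ℝ), 0 < δ → δ ≤ F.δcap → 9 / 5000 ≤ α → α < 1 → F.M261 δ ≤ (geo i).M →
      Ineq261 (d261 δ) (toB6 (geo i) (F.Rr i) (F.Hp i)) δ α) :
    B9SectBStepWhole.StepGlobPos F.dB c35 geo bg Gp GA Cinv GA := by
  intro B₀ δ₀ Bβ Bε Bεβ B₁ δ₁ hB₀ hδ₀ hB₁ hδ₁
  obtain ⟨a₁, ha₁, B, hB, H⟩ := entries342_ext_of_gFrame₂ F.toGFrame₂ d261 h261 hB₀ hδ₀ hB₁ hδ₁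
  have hδ6 : 0 < min (min δ₀ δ₁) F.δcap / 6 := by
    have hδr : 0 < min (min δ₀ δ₁) F.δcap := lt_min (lt_min hδ₀ hδ₁) F.δcap_pos
    positivity
  refine ⟨F.Mthr (min (min δ₀ δ₁) F.δcap), min a₁ F.aW, F.aInv, F.wGG B (min (min δ₀ δ₁) F.δcap / 6), F.Mthr_pos _,
    lt_min ha₁ F.aW_pos, F.aInv_pos, F.wGG_pos B _ hB hδ6, ?_⟩
  intro i hM α₀ hα₀ hMa U hU hT α₁ hα₁ ha U' hU'
  obtain ⟨-, e0, e1, e2, e3⟩ := H i α₀ U hM hα₀ hMa hU hT.1.1.1 hT.2.1 hT.2.2.1.1 α₁ U' hα₁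
    (le_trans ha (min_le_left _ _)) hU'
  exact F.writeGlobG i U U' α₁ B _ hα₁ (le_trans ha (min_le_right _ _)) hU' hB hδ6 e0 e1 e2 e3


/-! ## The analytic-extension step for G at the letters (13-An, G half) -/

variable (c35 geo bg Gp b κ S) in
/-- **THE LETTERS DICTIONARY FOR THE ANALYTIC EXTENSION OF G** — `GFrame₂` plus ONE field: at a (3.35)-regular U above the
thresholds and 0 < α₁ ≦ aW, if the frame's Δ_a(U′U) word `DeltaA i (U′U)` is inverted on both sides by the family's own G(U′U) for
EVERY U′ in the class (3.37) at α₁, then the layer's predicate `IsAnalyticExt i (GA i) U α₁` holds (instance: matrix inverse is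
analytic in A on a finite lattice, cf. `B9Eq386NeumannAnalytic`).  A hypothesis structure; nothing asserted.
[cite: Balaban1985BackgroundPropagators, Thm 3.4 p.400 + (3.84)–(3.86) p.407] -/
structure AnGFrame₂ (GA : ∀ i, B9.KernelFamily (geo i) (bg i)) (Cinv : ∀ i, B9.SiteKernel (geo i) (bg i))
    (IsAnalyticExt : ∀ i, B9.KernelFamily (geo i) (bg i) → (bg i).Cfg → ℝ → Prop)
    extends GFrame₂ c35 geo bg Gp b κ S GA Cinv where
  writeAnG : ∀ i (α₀ : ℝ) (U : (bg i).Cfg) (α₁ : ℝ), MInv ≤ (geo i).M → 0 < α₀ → (geo i).M * α₀ ≤ aInv →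
    (bg i).Reg335 c35 α₀ U → 0 < α₁ → α₁ ≤ aW →
    (∀ U' : (bg i).Cfg, (bg i).Cplx337 α₁ U U' →
      deltaA (conj b (lapDDLetter (T i) ((((geo i).eta : ℂ))⁻¹) (coord i ((bg i).mul U' U))))
          (conj b (dPrimeLetter (T i) (coord i ((bg i).mul U' U)) (geo i).eta))
          (conjHom b (gradLin (T i) ((((geo i).eta : ℂ))⁻¹) (coord i ((bg i).mul U' U))) ∘ₗ
              (1 - (Gop i ((bg i).mul U' U) ∘ₗ Qcs i ((bg i).mul U' U) ∘ₗ Cop i ((bg i).mul U' U) ∘ₗ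
                Qc i ((bg i).mul U' U) ∘ₗ Gop i ((bg i).mul U' U))) ∘ₗ
            conjHom b (divLin (T i) ((((geo i).eta : ℂ))⁻¹) (coord i ((bg i).mul U' U))))
          (Qsb i ((bg i).mul U' U)) (ab i) (Qb i ((bg i).mul U' U)) * Gb i ((bg i).mul U' U) = 1 ∧
      Gb i ((bg i).mul U' U) *
        deltaA (conj b (lapDDLetter (T i) ((((geo i).eta : ℂ))⁻¹) (coord i ((bg i).mul U' U))))
          (conj b (dPrimeLetter (T i) (coord i ((bg i).mul U' U)) (geo i).eta))
          (conjHom b (gradLin (T i) ((((geo i).eta : ℂ))⁻¹) (coord i ((bg i).mul U' U))) ∘ₗ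
              (1 - (Gop i ((bg i).mul U' U) ∘ₗ Qcs i ((bg i).mul U' U) ∘ₗ Cop i ((bg i).mul U' U) ∘ₗ
                Qc i ((bg i).mul U' U) ∘ₗ Gop i ((bg i).mul U' U))) ∘ₗ
            conjHom b (divLin (T i) ((((geo i).eta : ℂ))⁻¹) (coord i ((bg i).mul U' U))))
          (Qsb i ((bg i).mul U' U)) (ab i) (Qb i ((bg i).mul U' U)) = 1) →
    IsAnalyticExt i (GA i) U α₁

/-- ★ **THE ANALYTIC-EXTENSION STEP OF SECT. B FOR G, INHABITED AT THE LETTERS**: every `AnGFrame₂` inhabits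
`B9SectBStepWhole.StepAnalyticPos1 F.dB c35 geo bg Gp GA Cinv IsAnalyticExt GA` (the G half of `StepAnalyticPos`; the G′ half is
`B9SectBGpStepAtLettersV2.stepAnalyticPos1_of_anFrame₂`, merged by `B9SectBStepWhole.stepAnalyticPos_of_halves`).  Proof: the
inverse identities of `entries342_ext_of_gFrame₂` (GIVEN the Lemma-2.1 datum `(d261, h261)`, v2.1) for every U′ in the class at
α₁ ≦ min(a₁, aW), then `writeAnG`.
[cite: Balaban1985BackgroundPropagators, Thm 3.4 p.400 + (3.84)–(3.86) p.407] -/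
theorem stepAnalyticPos1_of_anGFrame₂ {GA : ∀ i, B9.KernelFamily (geo i) (bg i)} {Cinv : ∀ i, B9.SiteKernel (geo i) (bg i)}
    {IsAnalyticExt : ∀ i, B9.KernelFamily (geo i) (bg i) → (bg i).Cfg → ℝ → Prop}
    (F : AnGFrame₂ c35 geo bg Gp b κ S GA Cinv IsAnalyticExt) (d261 : ℝ → ℕ)
    (h261 : ∀ (i : I) (δ α : ℝ), 0 < δ → δ ≤ F.δcap → 9 / 5000 ≤ α → α < 1 → F.M261 δ ≤ (geo i).M →
      Ineq261 (d261 δ) (toB6 (geo i) (F.Rr i) (F.Hp i)) δ α) :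
    B9SectBStepWhole.StepAnalyticPos1 F.dB c35 geo bg Gp GA Cinv IsAnalyticExt GA := by
  intro B₀ δ₀ Bβ Bε Bεβ B₁ δ₁ hB₀ hδ₀ hB₁ hδ₁
  obtain ⟨a₁, ha₁, B, -, H⟩ := entries342_ext_of_gFrame₂ F.toGFrame₂ d261 h261 hB₀ hδ₀ hB₁ hδ₁
  refine ⟨F.Mthr (min (min δ₀ δ₁) F.δcap), min a₁ F.aW, F.aInv, PUnit.unit, F.Mthr_pos _, lt_min ha₁ F.aW_pos, F.aInv_pos,
    trivial, ?_⟩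
  intro i hM α₀ hα₀ hMa U hU hT α₁ hα₁ ha
  refine F.writeAnG i α₀ U α₁ (F.MInv_le_of_Mthr_le hM) hα₀ hMa hU hα₁ (le_trans ha (min_le_right _ _)) fun U' hU' => ?_
  exact (H i α₀ U hM hα₀ hMa hU hT.1.1.1 hT.2.1 hT.2.2.1.1 α₁ U' hα₁ (le_trans ha (min_le_left _ _)) hU').1

end Literature.MathematicalPhysics.QuantumFieldTheory.Balaban1983to89.B9SectBGStepAtLettersV2
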